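import Literature.NumberTheory.Li1992.RallisInnerProductThetaLift
import Literature.RepresentationTheory.CompactGroups.CharacterCompleteness
import HarnessLib

/-!
# [Li1992, Thm 2.1 (26)] at an automorphic CHARACTER of the second member: the diagonal inner product formula
# for `Θ_Φ(χ)` and the non-vanishing criterion «positive `χ̄`-Fourier coefficient of the Weil matrix coefficient»

J.-S. Li, *Non-vanishing theorems for the cohomology of certain arithmetic quotients*, J. reine angew. Math. **428**
(1992) 177–217 [Li1992], Theorem 2.1 (26) p. 184 and the «trivial observation» p. 178 («`θ^f_φ(g)` is non-zero if and
only if its Petersson norm `‖θ^f_φ(g)‖` is non-zero»); P. Fleig, H. Gustafsson, A. Kleinschmidt, D. Persson, *Eisenstein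
Series and Automorphic Representations* (2018), §12.3 Def. 12.5 (12.37) [FleigEtAl2018] (the lift `Θ_Φ(f)`, tree
`Weil1964.ThetaKernelDatum.thetaLift`).

Topic `NumberTheory/Li1992`; namespaces `Literature.NumberTheory.Li1992` (§1) and
`Literature.NumberTheory.Weil1964.ThetaKernelDatum` (§2).  KERNEL file: THEOREMS ONLY, proved from the definitions of
`RallisInnerProductThetaLift.lean` (`quotPairing`, `regularCoeff`, `rallisIntegrand`, the PROPERTY
`ThetaKernelDatum.RallisInnerProductIdentity`) and of `RepresentationTheory/CompactGroups/CharacterCompleteness.lean`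
(`charCM χ ∈ C(K, ℂ)` for a continuous unitary character `χ : PontryaginDual K`); nothing of [Li1992] is asserted — the
identity (26) enters only as the hypothesis `hR : M.RallisInnerProductIdentity ip dh μ ν` (the conclusion of the named fact
`RallisInnerProductFormulaUnitaryDualPair` for the tree's unitary dual pair).

SETTING (as in `GelbartRogawski1991/UnitaryDualPairThetaLiftCharacterCovariance.lean` §0): a theta-kernel datum
`M : ThetaKernelDatum Mp SX GU ΓU G Γ` whose second member has `Γ` NORMAL in `G` (e.g. `G = U(W)(𝔸)` ABELIAN, `W` a
hermitian line: `[U(W)] = G ⧸ Γ` is a compact abelian group), and an «automorphic character» `χ : PontryaginDual (G ⧸ Γ)`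
read as the continuous function `charCM χ` on `G ⧸ Γ` — print's `f ∈ π` for the one-dimensional automorphic
representation `π = χ` of `G'(A) = G`.

* §1 `regularCoeff_charCM` — print's matrix coefficient «`⟨π(h) f₁, f₂⟩ = ∫_{G'(k)\G'(A)} f₁(xh) \overline{f₂(x)} dx`»
  (p. 184) at `f₁ = f₂ = χ`: **`⟨π(h) χ, χ⟩_μ = μ([G']) · \overline{χ(h̄)}`** (`h̄ = hΓ`; in the tree's coset convention
  `(λ(h) χ)(q) = χ(h⁻¹ • q) = χ(h̄)⁻¹ χ(q)` and `|χ| = 1`); hence (`rallisIntegrand_charCM`,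
  `integral_rallisIntegrand_charCM`) the right-hand side of (26) on the diagonal `Φ₁ = Φ₂ = Φ`, `f₁ = f₂ = χ` is
  **`μ([G']) · ∫_{G} ⟨ω(h)Φ, Φ⟩ \overline{χ(h̄)} dh`** — the `χ̄`-FOURIER COEFFICIENT on `G` of the Weil matrix coefficient
  `h ↦ ⟨ω(h)Φ, Φ⟩` (`ω(h) := M.W.act (M.s (1, h))`, print's (25) «`F_φ(i(h, 1)) = ⟨ω(h)φ₁, φ₂⟩`»).
* §2 under `hR : M.RallisInnerProductIdentity ip dh μ ν`: `normSq_thetaLift_charCM_eq` — the diagonal formula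
  **`‖Θ_Φ(χ)‖²_ν = c · μ([G']) · ∫_G ⟨ω(h)Φ, Φ⟩ \overline{χ(h̄)} dh`** (one `c > 0` for all `Φ`, `χ`), and the
  NON-VANISHING CRITERION **`thetaLift_charCM_ne_zero_of_re_pos`**: if `μ ≠ 0` and the `χ̄`-Fourier coefficient of
  `h ↦ ⟨ω(h)Φ, Φ⟩` has positive real part, then `Θ_Φ(χ) ≠ 0` (print's «trivial observation», p. 178, through the tree's
  `RallisInnerProductIdentity.thetaLift_ne_zero_of_re_pos`).  This is the form in which the non-vanishing half of
  [Liu2021, proof of Prop. 4.13, l. 2145] consumes Theorem 2.1: what remains is the positivity of that Fourier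
  coefficient (print's factorised form (27) p. 184 and the local non-vanishing of §5 — NOT in this file).

## Mathlib / tree search
`lean search 'regularCoeff|rallisIntegrand'` — only `Li1992/RallisInnerProductThetaLift.lean` (definitions, the diagonal
case `exists_normSq_eq`, `thetaLift_ne_zero_of_re_pos`); `charCM` / `PontryaginDual (G ⧸ Γ)` as automorphic characters —
`GelbartRogawski1991/UnitaryDualPairThetaLiftCharacterCovariance.lean` (`thetaLift_act_right_charCM`: `Φ ↦ Θ_Φ(χ)` is
`(G, χ)`-covariant), `…ThetaLiftCharacterSpan.lean`, `…ThetaLiftGaussianCharacter.lean` (SOME character has a non-zero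
lift); no statement of (26) at a character.  Mathlib: `MulAction.Quotient.smul_coe`, `QuotientGroup.mk_mul`,
`Circle.coe_inv_eq_conj`, `Complex.mul_conj`, `Circle.normSq_coe`, `MeasureTheory.integral_const`, `integral_const_mul`.

## References
* [Li1992] J.-S. Li, J. reine angew. Math. 428 (1992) 177–217, doi:10.1515/crll.1992.428.177 — p. 178, (24)–(25) and
  Theorem 2.1 (26)–(27) p. 184.
* [FleigEtAl2018] P. Fleig, H. Gustafsson, A. Kleinschmidt, D. Persson, CUP (2018), §12.3 Def. 12.5 (12.37) p. 296.
* [Liu2021] Y. Liu, *Fourier–Jacobi cycles and arithmetic relative trace formula*, Camb. J. Math. 9 (2021), proof of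
  Prop. 4.13 (l. 2145 «Conversely …»).
-/

set_option autoImplicit false

noncomputable section

open _root_.MeasureTheory
open scoped ComplexConjugate
open Literature.NumberTheory.Weil1964 Literature.RepresentationTheory.CompactGroups

namespace Literature.NumberTheory.Li1992

/-! ## §1 The matrix coefficient of the regular representation at an automorphic character -/

section Regular

variable {G : Type*} [Group G] [TopologicalSpace G] [IsTopologicalGroup G] {Γ : Subgroup G} [Γ.Normal]

/-- Pointwise: `(λ(h) χ)(q) · \overline{χ(q)} = \overline{χ(h̄)}` for a unitary character `χ` of `G ⧸ Γ` and `q ∈ G ⧸ Γ`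
(`(λ(h) χ)(xΓ) = χ(h⁻¹xΓ) = χ(h̄)⁻¹ χ(xΓ)`, `χ(xΓ) \overline{χ(xΓ)} = 1`, `χ(h̄)⁻¹ = \overline{χ(h̄)}`).
[cite: Li1992, p. 184 (24)–(25)] -/
theorem leftTranslate_charCM_mul_conj (h : G) (χ : PontryaginDual (G ⧸ Γ)) (q : G ⧸ Γ) :
    leftTranslate Γ h (charCM χ) q * conj (charCM χ q) = conj ((χ (QuotientGroup.mk h) : Circle) : ℂ) := by
  induction q using QuotientGroup.induction_on with
  | H x =>
    simp only [leftTranslate_apply, charCM_apply, MulAction.Quotient.smul_coe, smul_eq_mul, QuotientGroup.mk_mul,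
      QuotientGroup.mk_inv, map_mul, map_inv, Circle.coe_mul, Circle.coe_inv_eq_conj, mul_assoc, Complex.mul_conj,
      Circle.normSq_coe, Complex.ofReal_one, mul_one]

variable [MeasurableSpace (G ⧸ Γ)] (μ : Measure (G ⧸ Γ))

/-- **`⟨π(h) χ, χ⟩ = μ([G']) · \overline{χ(h̄)}`**: print's matrix coefficient «`⟨π(h) f₁, f₂⟩ = ∫_{G'(k)\G'(A)} f₁(xh)
\overline{f₂(x)} dx`» of the regular representation (tree `regularCoeff μ h f₁ f₂ = ∫ f₁(h⁻¹ • q) \overline{f₂(q)} dμ`) at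
the automorphic character `f₁ = f₂ = χ` of the group `G ⧸ Γ` (`Γ` normal), for any measure `μ` on `G ⧸ Γ`
(`μ.real univ = μ([G'])`, `= 0` by convention if `μ` is infinite). [cite: Li1992, p. 184 (24)–(25)] -/
theorem regularCoeff_charCM (h : G) (χ : PontryaginDual (G ⧸ Γ)) :
    regularCoeff μ h (charCM χ) (charCM χ) =
      (μ.real Set.univ : ℂ) * conj ((χ (QuotientGroup.mk h) : Circle) : ℂ) := by
  rw [regularCoeff]
  simp_rw [leftTranslate_charCM_mul_conj h χ]
  rw [integral_const, Complex.real_smul]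

end Regular

/-! ## §2 (26) on the diagonal at `f = χ`: the `χ̄`-Fourier coefficient of the Weil matrix coefficient -/

section Theta

universe u v

variable {Mp : Type u} {SX : Type v} [TopologicalSpace Mp] [Group Mp] [TopologicalSpace SX]
variable {GU : Type*} [Group GU] [TopologicalSpace GU] {ΓU : Subgroup GU}
variable {G : Type*} [Group G] [TopologicalSpace G] [IsTopologicalGroup G] {Γ : Subgroup G} [Γ.Normal]
variable (M : ThetaKernelDatum Mp SX GU ΓU G Γ) (ip : SX → SX → ℂ)
variable [MeasurableSpace (G ⧸ Γ)] (μ : Measure (G ⧸ Γ))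

/-- **The integrand of (26) on the diagonal at an automorphic character**:
`⟨ω(h)Φ, Φ⟩ ⟨π(h) χ, χ⟩ = μ([G']) · ⟨ω(h)Φ, Φ⟩ · \overline{χ(h̄)}`, `ω(h) = M.W.act (M.s (1, h))`.
[cite: Li1992, Thm 2.1 (26) p. 184] -/
theorem rallisIntegrand_charCM (Φ : SX) (χ : PontryaginDual (G ⧸ Γ)) (h : G) :
    rallisIntegrand M ip μ Φ Φ (charCM χ) (charCM χ) h =
      (μ.real Set.univ : ℂ) * (ip (M.W.act (M.s (1, h)) Φ) Φ * conj ((χ (QuotientGroup.mk h) : Circle) : ℂ)) := by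
  rw [rallisIntegrand_apply, regularCoeff_charCM]
  ring

/-- **The right-hand side of (26) on the diagonal at `f = χ` is `μ([G'])` times the `χ̄`-FOURIER COEFFICIENT on `G` of
the Weil matrix coefficient `h ↦ ⟨ω(h)Φ, Φ⟩`**:
`∫_G ⟨ω(h)Φ, Φ⟩ ⟨π(h) χ, χ⟩ dh = μ([G']) · ∫_G ⟨ω(h)Φ, Φ⟩ \overline{χ(h̄)} dh` (for any measure `dh` on `G`; no
integrability needed, both sides being `0` together by Mathlib's convention). [cite: Li1992, Thm 2.1 (26)–(27) p. 184] -/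
theorem integral_rallisIntegrand_charCM [MeasurableSpace G] (dh : Measure G) (Φ : SX) (χ : PontryaginDual (G ⧸ Γ)) :
    ∫ h, rallisIntegrand M ip μ Φ Φ (charCM χ) (charCM χ) h ∂dh =
      (μ.real Set.univ : ℂ) * ∫ h, ip (M.W.act (M.s (1, h)) Φ) Φ * conj ((χ (QuotientGroup.mk h) : Circle) : ℂ) ∂dh := by
  simp_rw [rallisIntegrand_charCM M ip μ Φ χ]
  exact integral_const_mul _ _

end Theta

end Literature.NumberTheory.Li1992

/-! ### The two consequences of the identity (26) for the lift of a character -/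

namespace Literature.NumberTheory.Weil1964.ThetaKernelDatum.RallisInnerProductIdentity

open Literature.NumberTheory.Li1992

universe u v

variable {Mp : Type u} {SX : Type v} [TopologicalSpace Mp] [Group Mp] [TopologicalSpace SX]
variable {GU : Type*} [Group GU] [TopologicalSpace GU] [IsTopologicalGroup GU] {ΓU : Subgroup GU}
variable {G : Type*} [Group G] [TopologicalSpace G] [IsTopologicalGroup G] {Γ : Subgroup G} [Γ.Normal]
variable {M : ThetaKernelDatum Mp SX GU ΓU G Γ} {ip : SX → SX → ℂ}
variable [MeasurableSpace G] {dh : Measure G} [CompactSpace (GU ⧸ ΓU)] [MeasurableSpace (G ⧸ Γ)] {μ : Measure (G ⧸ Γ)}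
  [MeasurableSpace (GU ⧸ ΓU)] {ν : Measure (GU ⧸ ΓU)}

/-- **Rallis' inner product formula for the theta lift of an automorphic character** (diagonal case of (26) at
`f₁ = f₂ = χ`): under the identity (26) for the datum `M` there is ONE `c > 0` with, for every `Φ ∈ S(X_A)` and every
continuous unitary character `χ` of the compact group `G ⧸ Γ`,
`⟨Θ_Φ(χ), Θ_Φ(χ)⟩_ν = c · μ([G']) · ∫_G ⟨ω(h)Φ, Φ⟩ \overline{χ(h̄)} dh` — the Petersson norm of the lift of `χ`
([FleigEtAl2018, (12.37)]) is a positive multiple of the `χ̄`-Fourier coefficient on `G` of the Weil matrix coefficient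
`h ↦ ⟨ω(h)Φ, Φ⟩`. [cite: Li1992, Thm 2.1 (26) p. 184] [cite: FleigEtAl2018, §12.3 Def. 12.5 (12.37) p. 296] -/
theorem normSq_thetaLift_charCM_eq (hR : M.RallisInnerProductIdentity ip dh μ ν) :
    ∃ c : ℝ, 0 < c ∧ ∀ (Φ : SX) (χ : PontryaginDual (G ⧸ Γ)),
      quotPairing ν (M.thetaLift μ Φ (charCM χ)) (M.thetaLift μ Φ (charCM χ)) =
        (c : ℂ) * (μ.real Set.univ : ℂ) *
          ∫ h, ip (M.W.act (M.s (1, h)) Φ) Φ * conj ((χ (QuotientGroup.mk h) : Circle) : ℂ) ∂dh := by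
  obtain ⟨c, hc, h⟩ := hR.exists_normSq_eq
  refine ⟨c, hc, fun Φ χ => ?_⟩
  rw [h Φ (charCM χ), integral_rallisIntegrand_charCM, mul_assoc]

/-- **NON-VANISHING CRITERION FOR THE THETA LIFT OF A CHARACTER** (print's «trivial observation» p. 178 read through
(26) at `f = χ`): if Rallis' identity holds for the datum `M`, the source quotient has `μ([G']) ≠ 0` (finite), and the
`χ̄`-Fourier coefficient on `G` of the Weil matrix coefficient `h ↦ ⟨ω(h)Φ, Φ⟩` has POSITIVE REAL PART, then the theta lift
`Θ_Φ(χ)` of the automorphic character `χ` is not the zero function on `GU ⧸ ΓU`.  What a consumer must still supply is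
exactly that positivity (print: the factorisation (27) p. 184 and the local non-vanishing theorems of §5).
[cite: Li1992, p. 178 and Thm 2.1 (26)–(27) p. 184] [cite: FleigEtAl2018, §12.3 Def. 12.5 (12.37) p. 296] -/
theorem thetaLift_charCM_ne_zero_of_re_pos [IsFiniteMeasure μ] (hR : M.RallisInnerProductIdentity ip dh μ ν)
    (hμ : μ Set.univ ≠ 0) {Φ : SX} {χ : PontryaginDual (G ⧸ Γ)}
    (hpos : 0 < (∫ h, ip (M.W.act (M.s (1, h)) Φ) Φ * conj ((χ (QuotientGroup.mk h) : Circle) : ℂ) ∂dh).re) :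
    M.thetaLift μ Φ (charCM χ) ≠ 0 := by
  refine hR.thetaLift_ne_zero_of_re_pos ?_
  rw [integral_rallisIntegrand_charCM, Complex.re_ofReal_mul]
  exact mul_pos (ENNReal.toReal_pos hμ (measure_ne_top μ _)) hpos

/-- The same with the non-degeneracy of `μ` read from `μ.IsOpenPosMeasure` (the quotient `G ⧸ Γ` is non-empty): the
shape of the measures of the named fact `Li1992.RallisInnerProductFormulaUnitaryDualPair`.
[cite: Li1992, p. 178 and Thm 2.1 (26)–(27) p. 184] -/
theorem thetaLift_charCM_ne_zero_of_re_pos' [IsFiniteMeasure μ] [μ.IsOpenPosMeasure]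
    (hR : M.RallisInnerProductIdentity ip dh μ ν) {Φ : SX} {χ : PontryaginDual (G ⧸ Γ)}
    (hpos : 0 < (∫ h, ip (M.W.act (M.s (1, h)) Φ) Φ * conj ((χ (QuotientGroup.mk h) : Circle) : ℂ) ∂dh).re) :
    M.thetaLift μ Φ (charCM χ) ≠ 0 :=
  hR.thetaLift_charCM_ne_zero_of_re_pos (isOpen_univ.measure_ne_zero μ Set.univ_nonempty) hpos


/-! ### Edition 2: the OFF-DIAGONAL identity at `f₁ = f₂ = χ` and the polarised non-vanishing criterion

(26) is bilinear in `(Φ₁, Φ₂)`; at `f₁ = f₂ = χ` it reads `⟨Θ_{Φ₁}(χ), Θ_{Φ₂}(χ)⟩_ν = c · μ([G']) · ∫_G ⟨ω(h)Φ₁, Φ₂⟩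
\overline{χ(h̄)} dh`, so ONE non-vanishing `χ̄`-Fourier coefficient of an off-diagonal Weil matrix coefficient
`h ↦ ⟨ω(h)Φ₁, Φ₂⟩` already forces BOTH lifts `Θ_{Φ₁}(χ)`, `Θ_{Φ₂}(χ)` to be non-zero — the consumer's local work is a
NON-VANISHING statement with two free test vectors, not a positivity statement. -/

section OffDiagonal

omit [IsTopologicalGroup GU] [CompactSpace (GU ⧸ ΓU)] in
/-- `⟨0, F⟩ = 0` for the Petersson pairing. [cite: Li1992, (9) p. 181] -/
theorem _root_.Literature.NumberTheory.Li1992.quotPairing_zero_left' (F : C(GU ⧸ ΓU, ℂ)) :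
    quotPairing ν 0 F = 0 := by
  simp [quotPairing]

omit [IsTopologicalGroup GU] [CompactSpace (GU ⧸ ΓU)] in
/-- `⟨F, 0⟩ = 0` for the Petersson pairing. [cite: Li1992, (9) p. 181] -/
theorem _root_.Literature.NumberTheory.Li1992.quotPairing_zero_right (F : C(GU ⧸ ΓU, ℂ)) :
    quotPairing ν F 0 = 0 := by
  simp [quotPairing]

omit [IsTopologicalGroup GU] [MeasurableSpace G] [CompactSpace (GU ⧸ ΓU)] [MeasurableSpace (GU ⧸ ΓU)] in
/-- **The integrand of (26) at `f₁ = f₂ = χ`, two Schwartz arguments**: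
`⟨ω(h)Φ₁, Φ₂⟩ ⟨π(h) χ, χ⟩ = μ([G']) · ⟨ω(h)Φ₁, Φ₂⟩ · \overline{χ(h̄)}`. [cite: Li1992, Thm 2.1 (26) p. 184] -/
theorem _root_.Literature.NumberTheory.Li1992.rallisIntegrand_charCM₂ (Φ₁ Φ₂ : SX) (χ : PontryaginDual (G ⧸ Γ))
    (h : G) :
    rallisIntegrand M ip μ Φ₁ Φ₂ (charCM χ) (charCM χ) h =
      (μ.real Set.univ : ℂ) * (ip (M.W.act (M.s (1, h)) Φ₁) Φ₂ * conj ((χ (QuotientGroup.mk h) : Circle) : ℂ)) := by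
  rw [rallisIntegrand_apply, regularCoeff_charCM]
  ring

omit [IsTopologicalGroup GU] [CompactSpace (GU ⧸ ΓU)] [MeasurableSpace (GU ⧸ ΓU)] in
/-- **The right-hand side of (26) at `f₁ = f₂ = χ`, two Schwartz arguments** = `μ([G'])` times the `χ̄`-Fourier
coefficient on `G` of the off-diagonal Weil matrix coefficient `h ↦ ⟨ω(h)Φ₁, Φ₂⟩`. [cite: Li1992, Thm 2.1 (26)–(27) p. 184] -/
theorem _root_.Literature.NumberTheory.Li1992.integral_rallisIntegrand_charCM₂ (Φ₁ Φ₂ : SX)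
    (χ : PontryaginDual (G ⧸ Γ)) :
    ∫ h, rallisIntegrand M ip μ Φ₁ Φ₂ (charCM χ) (charCM χ) h ∂dh =
      (μ.real Set.univ : ℂ) *
        ∫ h, ip (M.W.act (M.s (1, h)) Φ₁) Φ₂ * conj ((χ (QuotientGroup.mk h) : Circle) : ℂ) ∂dh := by
  simp_rw [rallisIntegrand_charCM₂ (M := M) (ip := ip) (μ := μ) Φ₁ Φ₂ χ]
  exact integral_const_mul _ _

/-- **(26) at an automorphic character, off the diagonal**: under Rallis' identity there is ONE `c > 0` with
`⟨Θ_{Φ₁}(χ), Θ_{Φ₂}(χ)⟩_ν = c · μ([G']) · ∫_G ⟨ω(h)Φ₁, Φ₂⟩ \overline{χ(h̄)} dh` for all `Φ₁ Φ₂ ∈ S(X_A)` and all characters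
`χ` of `G ⧸ Γ`. [cite: Li1992, Thm 2.1 (26) p. 184] [cite: FleigEtAl2018, §12.3 Def. 12.5 (12.37) p. 296] -/
theorem inner_thetaLift_charCM_eq (hR : M.RallisInnerProductIdentity ip dh μ ν) :
    ∃ c : ℝ, 0 < c ∧ ∀ (Φ₁ Φ₂ : SX) (χ : PontryaginDual (G ⧸ Γ)),
      quotPairing ν (M.thetaLift μ Φ₁ (charCM χ)) (M.thetaLift μ Φ₂ (charCM χ)) =
        (c : ℂ) * (μ.real Set.univ : ℂ) *
          ∫ h, ip (M.W.act (M.s (1, h)) Φ₁) Φ₂ * conj ((χ (QuotientGroup.mk h) : Circle) : ℂ) ∂dh := by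
  obtain ⟨c, hc, h⟩ := hR
  refine ⟨c, hc, fun Φ₁ Φ₂ χ => ?_⟩
  rw [(h Φ₁ Φ₂ (charCM χ) (charCM χ)).2, integral_rallisIntegrand_charCM₂, mul_assoc]

/-- **POLARISED NON-VANISHING CRITERION**: if Rallis' identity holds for `M`, `μ([G']) ≠ 0` (finite), and for SOME pair of
test vectors `Φ₁, Φ₂` the `χ̄`-Fourier coefficient `∫_G ⟨ω(h)Φ₁, Φ₂⟩ \overline{χ(h̄)} dh` of the off-diagonal Weil matrix
coefficient is NON-ZERO, then BOTH theta lifts `Θ_{Φ₁}(χ)` and `Θ_{Φ₂}(χ)` are non-zero functions on `GU ⧸ ΓU`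
(their Petersson pairing is a non-zero multiple of that coefficient).  No positivity or real part is required of the
consumer. [cite: Li1992, p. 178 and Thm 2.1 (26)–(27) p. 184] [cite: FleigEtAl2018, §12.3 Def. 12.5 (12.37) p. 296] -/
theorem thetaLift_charCM_ne_zero_of_fourierCoeff_ne_zero [IsFiniteMeasure μ]
    (hR : M.RallisInnerProductIdentity ip dh μ ν) (hμ : μ Set.univ ≠ 0) {Φ₁ Φ₂ : SX} {χ : PontryaginDual (G ⧸ Γ)}
    (hne : ∫ h, ip (M.W.act (M.s (1, h)) Φ₁) Φ₂ * conj ((χ (QuotientGroup.mk h) : Circle) : ℂ) ∂dh ≠ 0) :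
    M.thetaLift μ Φ₁ (charCM χ) ≠ 0 ∧ M.thetaLift μ Φ₂ (charCM χ) ≠ 0 := by
  obtain ⟨c, hc, h⟩ := inner_thetaLift_charCM_eq hR
  have key := h Φ₁ Φ₂ χ
  have hμr : (μ.real Set.univ : ℂ) ≠ 0 :=
    Complex.ofReal_ne_zero.2 (ENNReal.toReal_pos hμ (measure_ne_top μ _)).ne'
  have hrhs : (c : ℂ) * (μ.real Set.univ : ℂ) *
      ∫ h, ip (M.W.act (M.s (1, h)) Φ₁) Φ₂ * conj ((χ (QuotientGroup.mk h) : Circle) : ℂ) ∂dh ≠ 0 :=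
    mul_ne_zero (mul_ne_zero (Complex.ofReal_ne_zero.2 hc.ne') hμr) hne
  refine ⟨fun h0 => hrhs ?_, fun h0 => hrhs ?_⟩
  · rw [← key, h0, quotPairing_zero_left']
  · rw [← key, h0, quotPairing_zero_right]

/-- The polarised criterion with `μ.IsOpenPosMeasure` (the measures of `Li1992.RallisInnerProductFormulaUnitaryDualPair`).
[cite: Li1992, p. 178 and Thm 2.1 (26)–(27) p. 184] -/
theorem thetaLift_charCM_ne_zero_of_fourierCoeff_ne_zero' [IsFiniteMeasure μ] [μ.IsOpenPosMeasure]
    (hR : M.RallisInnerProductIdentity ip dh μ ν) {Φ₁ Φ₂ : SX} {χ : PontryaginDual (G ⧸ Γ)}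
    (hne : ∫ h, ip (M.W.act (M.s (1, h)) Φ₁) Φ₂ * conj ((χ (QuotientGroup.mk h) : Circle) : ℂ) ∂dh ≠ 0) :
    M.thetaLift μ Φ₁ (charCM χ) ≠ 0 ∧ M.thetaLift μ Φ₂ (charCM χ) ≠ 0 :=
  thetaLift_charCM_ne_zero_of_fourierCoeff_ne_zero hR (isOpen_univ.measure_ne_zero μ Set.univ_nonempty) hne

end OffDiagonal

end Literature.NumberTheory.Weil1964.ThetaKernelDatum.RallisInnerProductIdentity

end
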